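import Summits.ValiantsHypothesis.ValiantsHypothesis.Theses.BorderApolarity
import Literature.Computability.AlgebraicComplexity.Apolarity

/-! drefute probe: is `stub_h0Elementary` provable exactly as stated (coercions, `let`s, `if`-rk)? -/

open MvPolynomial Filter
open scoped BigOperators Matrix
open Literature.Computability.AlgebraicComplexity

namespace DrefuteProbe

section Transv
variable {ι : Type*} [Fintype ι] [DecidableEq ι]

omit [Fintype ι] in
theorem transv_apply (y z a b : ι) (c : ℂ) :
    ((1 : Matrix ι ι ℂ) + c • Matrix.single y z (1 : ℂ)) a b =
      (if a = b then (1 : ℂ) else 0) + c * (if y = a ∧ z = b then 1 else 0) := by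
  simp only [Matrix.add_apply, Matrix.one_apply, Matrix.smul_apply, Matrix.single_apply, smul_eq_mul]

omit [Fintype ι] in
theorem transv_diag {y z : ι} (hyz : y ≠ z) (c : ℂ) (p : ι) :
    ((1 : Matrix ι ι ℂ) + c • Matrix.single y z (1 : ℂ)) p p = 1 := by
  rw [transv_apply, if_pos rfl, if_neg]
  · ring
  · rintro ⟨h1, h2⟩
    exact hyz (h1.trans h2.symm)

omit [Fintype ι] in
theorem transv_offdiag {y z a b : ι} (hab : a ≠ b) (c : ℂ) :
    ((1 : Matrix ι ι ℂ) + c • Matrix.single y z (1 : ℂ)) a b = c * (if y = a ∧ z = b then 1 else 0) := by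
  rw [transv_apply, if_neg hab, zero_add]

theorem transv_det {y z : ι} (hyz : y ≠ z) (c : ℂ) :
    ((1 : Matrix ι ι ℂ) + c • Matrix.single y z (1 : ℂ)).det = 1 := by
  have : (1 : Matrix ι ι ℂ) + c • Matrix.single y z (1 : ℂ) = Matrix.transvection y z c := by
    simp [Matrix.transvection]
  rw [this, Matrix.det_transvection_of_ne _ _ hyz]

omit [Fintype ι] in
theorem transv_transpose (y z : ι) (c : ℂ) :
    ((1 : Matrix ι ι ℂ) + c • Matrix.single y z (1 : ℂ))ᵀ = 1 + c • Matrix.single z y (1 : ℂ) := by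
  rw [Matrix.transpose_add, Matrix.transpose_one, Matrix.transpose_smul, Matrix.transpose_single]

theorem diagUpdate_det (z : ι) {d : ℂ} (hd : d ≠ 0) :
    (Matrix.diagonal (Function.update (1 : ι → ℂ) z d)).det ≠ 0 := by
  rw [Matrix.det_diagonal, Finset.prod_update_of_mem (Finset.mem_univ z)]
  simp [hd]

omit [Fintype ι] in
theorem diagUpdate_apply_of_ne {z p : ι} (h : p ≠ z) (d : ℂ) :
    Matrix.diagonal (Function.update (1 : ι → ℂ) z d) p p = 1 := by
  rw [Matrix.diagonal_apply_eq, Function.update_of_ne h, Pi.one_apply]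

end Transv

theorem rk_own_lt {m : ℕ} (p : Fin m × Fin m) : (p.1 : ℕ) * m + (p.2 : ℕ) < m * m := by
  have h1 : (p.1 : ℕ) + 1 ≤ m := p.1.isLt
  have h2 : (p.2 : ℕ) < m := p.2.isLt
  calc (p.1 : ℕ) * m + p.2 < p.1 * m + m := Nat.add_lt_add_left h2 _
    _ = ((p.1 : ℕ) + 1) * m := by ring
    _ ≤ m * m := Nat.mul_le_mul_right m h1

/-- Stub 2 verbatim. -/
theorem stub_h0Elementary (n m : ℕ) [NeZero m] (J : ℕ → Set (MvPolynomial (Fin m × Fin m) ℂ))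
    (hW4 : ∀ A : Matrix.GeneralLinearGroup (Fin m × Fin m) ℂ,
      let M : Matrix (Fin m × Fin m) (Fin m × Fin m) ℂ := A
      let rk := fun (p : Fin m × Fin m) =>
        (if (m - n ≤ (p.1 : ℕ) ∧ m - n ≤ (p.2 : ℕ)) ∨ p = (0, 0) then 0 else m * m) + ((p.1 : ℕ) * m + (p.2 : ℕ))
      (∀ i j : Fin m × Fin m, M j i ≠ 0 → rk j ≤ rk i) →
      (∀ i j : Fin m × Fin m, ((m - n ≤ (i.1 : ℕ) ∧ m - n ≤ (i.2 : ℕ)) ∨ i = (0, 0)) → j ≠ i → M j i = 0) →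
      (∀ i k j l : Fin m, m - n ≤ (i : ℕ) → m - n ≤ (k : ℕ) → m - n ≤ (j : ℕ) → m - n ≤ (l : ℕ) →
        M (i, j) (i, j) * M (k, l) (k, l) = M (i, l) (i, l) * M (k, j) (k, j)) →
      M (0, 0) (0, 0) ^ (m - n) * ∏ i ∈ Finset.univ.filter (fun i : Fin m => m - n ≤ (i : ℕ)), M (i, i) (i, i) = 1 →
      ∀ k ≤ m, ∀ D ∈ J k, linSubst (Fin m × Fin m) ℂ Mᵀ D ∈ J k) :
    ∀ k ≤ m,
      (∀ y z : Fin m × Fin m,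
        ((m - n ≤ (y.1 : ℕ) ∧ m - n ≤ (y.2 : ℕ)) ∨ y = (0, 0)) →
        ¬ ((m - n ≤ (z.1 : ℕ) ∧ m - n ≤ (z.2 : ℕ)) ∨ z = (0, 0)) →
        ∀ c : ℂ, ∀ D ∈ J k, linSubst (Fin m × Fin m) ℂ (1 + c • Matrix.single z y (1 : ℂ)) D ∈ J k) ∧
      (∀ z : Fin m × Fin m,
        ¬ ((m - n ≤ (z.1 : ℕ) ∧ m - n ≤ (z.2 : ℕ)) ∨ z = (0, 0)) →
        ∀ d : ℂ, d ≠ 0 → ∀ D ∈ J k,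
          linSubst (Fin m × Fin m) ℂ (Matrix.diagonal (Function.update 1 z d)) D ∈ J k) := by
  classical
  intro k hk
  constructor
  · intro y z hy hz c D hD
    have hyz : y ≠ z := by
      rintro rfl
      exact hz hy
    have key := hW4 (Matrix.GeneralLinearGroup.mkOfDetNeZero _ ((transv_det hyz c).symm ▸ one_ne_zero))
    simp only [Matrix.GeneralLinearGroup.val_mkOfDetNeZero, transv_transpose] at key
    refine key ?_ ?_ ?_ ?_ k hk D hD
    · intro i j hij
      by_cases hji : j = i
      · subst hji
        exact le_rfl
      · rw [transv_offdiag hji] at hij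
        have hyj : y = j ∧ z = i := by
          by_contra hcon
          rw [if_neg hcon, mul_zero] at hij
          exact hij rfl
        obtain ⟨rfl, rfl⟩ := hyj
        rw [if_pos hy, if_neg hz]
        have := rk_own_lt y
        omega
    · intro i j hi hji
      rw [transv_offdiag hji, if_neg, mul_zero]
      rintro ⟨rfl, rfl⟩
      exact hz hi
    · intro i k' j l _ _ _ _
      simp only [transv_diag hyz]
    · simp only [transv_diag hyz, one_pow, one_mul, Finset.prod_const_one]
  · intro z hz d hd D hD
    have hz' : ∀ p : Fin m × Fin m, ((m - n ≤ (p.1 : ℕ) ∧ m - n ≤ (p.2 : ℕ)) ∨ p = (0, 0)) → p ≠ z := by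
      rintro p hp rfl
      exact hz hp
    have key := hW4 (Matrix.GeneralLinearGroup.mkOfDetNeZero _ (diagUpdate_det z hd))
    simp only [Matrix.GeneralLinearGroup.val_mkOfDetNeZero, Matrix.diagonal_transpose] at key
    refine key ?_ ?_ ?_ ?_ k hk D hD
    · intro i j hij
      by_cases hji : j = i
      · subst hji
        exact le_rfl
      · exact absurd (Matrix.diagonal_apply_ne _ hji) hij
    · intro i j _ hji
      exact Matrix.diagonal_apply_ne _ hji
    · intro i k' j l hi hk' hj hl
      rw [diagUpdate_apply_of_ne (hz' _ (Or.inl ⟨hi, hj⟩)), diagUpdate_apply_of_ne (hz' _ (Or.inl ⟨hk', hl⟩)),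
        diagUpdate_apply_of_ne (hz' _ (Or.inl ⟨hi, hl⟩)), diagUpdate_apply_of_ne (hz' _ (Or.inl ⟨hk', hj⟩))]
    · rw [diagUpdate_apply_of_ne (hz' _ (Or.inr rfl)), one_pow, one_mul]
      refine Finset.prod_eq_one fun i hi => ?_
      rw [Finset.mem_filter] at hi
      exact diagUpdate_apply_of_ne (hz' _ (Or.inl ⟨hi.2, hi.2⟩)) d

end DrefuteProbe

#print axioms DrefuteProbe.stub_h0Elementary
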